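import Mathlib
import Literature.NumberTheory.Transcendental.KZHyperbolicLadder
import Literature.NumberTheory.Transcendental.KZCalculusProofs

/-!
# `OffTetraSectorKernel` (stmt-KontsevichZagierPeriods-10557), line `odd-hyperbolic-ladder`:
# normal form of rung-2 polytopes in the paraboloid lift

Stub `stub_rungTwoNormalForm`. Rung 2 of the hyperbolic scissors ladder consists of the volumes of
finite-volume `ℚ̄`-geodesic polytopes of hyperbolic 3-space (upper half-space model,
`p : Fin 3 → ℝ`, height `t = p 2 = p (Fin.last 2) > 0`). In the PARABOLOID LIFT
`Ql p = (|p|², p 0, p 1, 1)` both kinds of faces of `KZ.IsGeodesicPolytope 2` are linear: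
a vertical plane `ε (a₀ p₀ + a₁ p₁ − c)` is the row `ε • (0, a₀, a₁, −c)` and a hemisphere
`ε (|p − a|² − c)` (`a₂ = 0`) is the row `ε • (1, −2a₀, −2a₁, a₀² + a₁² − c)`; all entries are
real algebraic. The NORMAL FORM keeps the set `P` and normalises the list of rows: choose a
MINIMAL sub-list of rows cutting out the same set (well-foundedness of `⊂` on `Finset`);
minimality says that no row can be dropped, i.e. for every kept row there is a point of the
half-space violating it (value `≤ 0`) and satisfying all the other kept rows. Consequences, for a
nonempty `P`: (ND1) every kept row is NEGATIVE somewhere in the half-space (a lifted constraint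
`A|p|² + Bp₀ + Cp₁ + D` which is `≤ 0` at a point of the half-space and `> 0` at a point of `P` is
`< 0` nearby: halve or double the height if `A ≠ 0`, reflect the positive point through the
non-positive one if `A = 0`); (ND2) the kept rows are pairwise NON-PROPORTIONAL (`Lᵢ = μ Lⱼ`:
at a point of `P` both values are positive, so `μ > 0`, and then the violating point of row `i`
would violate row `j`); (trace) every kept row has a non-zero trace part `(Lᵢ₀, Lᵢ₁, Lᵢ₂)`
(otherwise the constraint is the constant `Lᵢ₃`, positive at a point of `P` and non-positive at
the violating point). Re-indexing the kept rows by `Fin` (`Finset.orderEmbOfFin`) gives the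
stated normal form.

References: A. B. Goncharov, *Volumes of hyperbolic manifolds and mixed Tate motives* (1999), §1.1;
M. Kontsevich, D. Zagier, *Periods* (2001), §1.2.
-/

noncomputable section

open Set MeasureTheory
open Literature.NumberTheory.Transcendental

namespace Summit.KontsevichZagierPeriods.HyperbolicBloch.OffTetraSectorKernel

/-- Closed form of a lifted constraint: `L • Ql p = L 0 |p|² + L 1 p₀ + L 2 p₁ + L 3`. [folklore] -/
theorem nf_eval {Ql : (Fin 3 → ℝ) → Fin 4 → ℝ}
    (hQl : ∀ p, Ql p = ![p 0 ^ 2 + p 1 ^ 2 + p 2 ^ 2, p 0, p 1, 1]) (L : Fin 4 → ℝ) (p : Fin 3 → ℝ) :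
    ∑ c, L c * Ql p c = L 0 * (p 0 ^ 2 + p 1 ^ 2 + p 2 ^ 2) + L 1 * p 0 + L 2 * p 1 + L 3 := by
  rw [hQl, Fin.sum_univ_four]
  simp

/-- Sign improvement in the upper half-space: a lifted constraint `A|p|² + Bp₀ + Cp₁ + D` which is
`≤ 0` at a point `p` of the upper half-space and `> 0` at some point `q` is `< 0` at a point of the
upper half-space — double the height of `p` if `A < 0`, halve it if `A > 0`, and reflect `q` through
`p` (at height `1`) if `A = 0`. [folklore] -/
theorem nf_exists_neg (L : Fin 4 → ℝ) (p q : Fin 3 → ℝ) (hp : 0 < p 2)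
    (hle : L 0 * (p 0 ^ 2 + p 1 ^ 2 + p 2 ^ 2) + L 1 * p 0 + L 2 * p 1 + L 3 ≤ 0)
    (hq : 0 < L 0 * (q 0 ^ 2 + q 1 ^ 2 + q 2 ^ 2) + L 1 * q 0 + L 2 * q 1 + L 3) :
    ∃ r : Fin 3 → ℝ, 0 < r 2 ∧
      L 0 * (r 0 ^ 2 + r 1 ^ 2 + r 2 ^ 2) + L 1 * r 0 + L 2 * r 1 + L 3 < 0 := by
  have hp2 : 0 < p 2 ^ 2 := by positivity
  rcases lt_trichotomy (L 0) 0 with hA | hA | hA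
  · refine ⟨![p 0, p 1, 2 * p 2], ?_, ?_⟩
    · show 0 < 2 * p 2
      linarith
    · show L 0 * (p 0 ^ 2 + p 1 ^ 2 + (2 * p 2) ^ 2) + L 1 * p 0 + L 2 * p 1 + L 3 < 0
      have h3 : L 0 * (p 0 ^ 2 + p 1 ^ 2 + (2 * p 2) ^ 2) + L 1 * p 0 + L 2 * p 1 + L 3 =
          (L 0 * (p 0 ^ 2 + p 1 ^ 2 + p 2 ^ 2) + L 1 * p 0 + L 2 * p 1 + L 3) +
            3 * (L 0 * p 2 ^ 2) := by ring
      rw [h3]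
      nlinarith [mul_neg_of_neg_of_pos hA hp2]
  · refine ⟨![2 * p 0 - q 0, 2 * p 1 - q 1, 1], ?_, ?_⟩
    · show (0 : ℝ) < 1
      exact one_pos
    · show L 0 * ((2 * p 0 - q 0) ^ 2 + (2 * p 1 - q 1) ^ 2 + 1 ^ 2) + L 1 * (2 * p 0 - q 0) +
          L 2 * (2 * p 1 - q 1) + L 3 < 0
      rw [hA] at hle hq ⊢
      linarith
  · refine ⟨![p 0, p 1, p 2 / 2], ?_, ?_⟩
    · show 0 < p 2 / 2
      linarith
    · show L 0 * (p 0 ^ 2 + p 1 ^ 2 + (p 2 / 2) ^ 2) + L 1 * p 0 + L 2 * p 1 + L 3 < 0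
      have h3 : L 0 * (p 0 ^ 2 + p 1 ^ 2 + (p 2 / 2) ^ 2) + L 1 * p 0 + L 2 * p 1 + L 3 =
          (L 0 * (p 0 ^ 2 + p 1 ^ 2 + p 2 ^ 2) + L 1 * p 0 + L 2 * p 1 + L 3) -
            3 / 4 * (L 0 * p 2 ^ 2) := by ring
      rw [h3]
      nlinarith [mul_pos hA hp2]

/-- Minimal constraint sub-family: among the finsets of constraint indices cutting out (inside `H`)
the same set as the whole family there is a `⊂`-minimal one, and minimality says that no single
index can be erased: for each kept index there is a point of `H` violating its constraint and
satisfying all the other kept constraints. [folklore] -/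
theorem nf_exists_minimal {X : Type*} {k : ℕ} (H : Set X) (f : Fin k → X → ℝ) :
    ∃ S : Finset (Fin k),
      {x | x ∈ H ∧ ∀ i ∈ S, 0 < f i x} = {x | x ∈ H ∧ ∀ i, 0 < f i x} ∧
      ∀ i ∈ S, ∃ x, x ∈ H ∧ f i x ≤ 0 ∧ ∀ j ∈ S, j ≠ i → 0 < f j x := by
  obtain ⟨S, hS, hmin⟩ := (Finset.isWellFounded_ssubset (α := Fin k)).wf.has_min
    {S : Finset (Fin k) | {x | x ∈ H ∧ ∀ i ∈ S, 0 < f i x} = {x | x ∈ H ∧ ∀ i, 0 < f i x}}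
    ⟨Finset.univ, by
      show _ = _
      ext x
      simp⟩
  replace hS : {x | x ∈ H ∧ ∀ i ∈ S, 0 < f i x} = {x | x ∈ H ∧ ∀ i, 0 < f i x} := hS
  refine ⟨S, hS, fun i hi => ?_⟩
  by_contra hcon
  push Not at hcon
  refine hmin (S.erase i) ?_ (Finset.erase_ssubset hi)
  show {x | x ∈ H ∧ ∀ j ∈ S.erase i, 0 < f j x} = {x | x ∈ H ∧ ∀ i, 0 < f i x}
  rw [← hS]
  ext x
  simp only [Set.mem_setOf_eq, Finset.mem_erase]
  constructor
  · rintro ⟨hx, hall⟩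
    refine ⟨hx, fun j hj => ?_⟩
    by_cases hji : j = i
    · rw [hji]
      by_contra hle
      obtain ⟨j', hj'S, hj'i, hj'le⟩ := hcon x hx (not_lt.1 hle)
      exact absurd (hall j' ⟨hj'i, hj'S⟩) (not_lt.2 hj'le)
    · exact hall j ⟨hji, hj⟩
  · rintro ⟨hx, hall⟩
    exact ⟨hx, fun j hj => hall j hj.2⟩

/-- A vector of four algebraic reals has algebraic entries. [folklore] -/
theorem nf_algebraic_vec4 {x y z w : ℝ} (hx : IsAlgebraic ℚ x) (hy : IsAlgebraic ℚ y)
    (hz : IsAlgebraic ℚ z) (hw : IsAlgebraic ℚ w) :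
    ∀ c, IsAlgebraic ℚ ((![x, y, z, w] : Fin 4 → ℝ) c) := by
  intro c
  fin_cases c
  exacts [hx, hy, hz, hw]

/-- Closed form of the lifted constraint of an explicit row `(x, y, z, w)`. [folklore] -/
theorem nf_eval_vec {Ql : (Fin 3 → ℝ) → Fin 4 → ℝ}
    (hQl : ∀ p, Ql p = ![p 0 ^ 2 + p 1 ^ 2 + p 2 ^ 2, p 0, p 1, 1]) (x y z w : ℝ) (p : Fin 3 → ℝ) :
    ∑ c, (![x, y, z, w] : Fin 4 → ℝ) c * Ql p c =
      x * (p 0 ^ 2 + p 1 ^ 2 + p 2 ^ 2) + y * p 0 + z * p 1 + w := by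
  rw [nf_eval hQl]
  rfl

/-- The paraboloid lift linearises the rung-2 constraints: with rows `L₀ i ∈ ℚ̄⁴` — a vertical plane
`ε (Σ aₗ pₗ − d)` (`a₂ = 0`) is the row `(0, ε a₀, ε a₁, −ε d)`, a hemisphere `ε (Σ (pₗ − aₗ)² − d)`
is the row `(ε, −2ε a₀, −2ε a₁, ε (a₀² + a₁² − d))` — the polytope is `{t > 0} ∩ ⋂ᵢ {0 < L₀ i • Ql p}`.
[cite: Goncharov1999, §1.1] -/
theorem nf_rows_of_data {Ql : (Fin 3 → ℝ) → Fin 4 → ℝ}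
    (hQl : ∀ p, Ql p = ![p 0 ^ 2 + p 1 ^ 2 + p 2 ^ 2, p 0, p 1, 1])
    {k : ℕ} (flat : Fin k → Bool) (a : Fin k → Fin 3 → ℝ) (d ε : Fin k → ℝ)
    (ha : ∀ i l, IsAlgebraic ℚ (a i l)) (hd : ∀ i, IsAlgebraic ℚ (d i))
    (hε : ∀ i, ε i = 1 ∨ ε i = -1) (hlast : ∀ i, a i 2 = 0) :
    ∃ L₀ : Fin k → Fin 4 → ℝ, (∀ i c, IsAlgebraic ℚ (L₀ i c)) ∧
      {p : Fin 3 → ℝ | 0 < p 2 ∧ ∀ i, 0 < ε i *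
          (if flat i then (∑ l, a i l * p l) - d i else (∑ l, (p l - a i l) ^ 2) - d i)} =
        {p | 0 < p 2 ∧ ∀ i, 0 < ∑ c, L₀ i c * Ql p c} := by
  have hεalg : ∀ i, IsAlgebraic ℚ (ε i) := by
    intro i
    rcases hε i with h | h <;> rw [h]
    · exact isAlgebraic_one
    · exact isAlgebraic_one.neg
  have h2alg : IsAlgebraic ℚ (2 : ℝ) := by exact_mod_cast isAlgebraic_nat (R := ℚ) (A := ℝ) 2
  obtain ⟨L₀, hL₀⟩ : ∃ L₀ : Fin k → Fin 4 → ℝ, ∀ i, L₀ i =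
      if flat i = true then ![0, ε i * a i 0, ε i * a i 1, -(ε i * d i)]
      else ![ε i, -(2 * ε i * a i 0), -(2 * ε i * a i 1), ε i * (a i 0 ^ 2 + a i 1 ^ 2 - d i)] :=
    ⟨_, fun i => rfl⟩
  refine ⟨L₀, fun i => ?_, ?_⟩
  · rw [hL₀ i]
    by_cases hb : flat i = true
    · rw [if_pos hb]
      exact nf_algebraic_vec4 isAlgebraic_zero ((hεalg i).mul (ha i 0)) ((hεalg i).mul (ha i 1))
        ((hεalg i).mul (hd i)).neg
    · rw [if_neg hb]
      exact nf_algebraic_vec4 (hεalg i) ((h2alg.mul (hεalg i)).mul (ha i 0)).neg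
        ((h2alg.mul (hεalg i)).mul (ha i 1)).neg
        ((hεalg i).mul ((((ha i 0).pow 2).add ((ha i 1).pow 2)).sub (hd i)))
  · ext p
    simp only [Set.mem_setOf_eq]
    refine and_congr_right fun _ => forall_congr' fun i => ?_
    have key : ∑ c, L₀ i c * Ql p c =
        ε i * (if flat i then (∑ l, a i l * p l) - d i else (∑ l, (p l - a i l) ^ 2) - d i) := by
      rw [hL₀ i]
      by_cases hb : flat i = true
      · rw [if_pos hb, if_pos hb, nf_eval_vec hQl, Fin.sum_univ_three, hlast i]
        ring
      · rw [if_neg hb, if_neg hb, nf_eval_vec hQl, Fin.sum_univ_three, hlast i]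
        ring
    rw [key]

/-- The paraboloid lift linearises rung-2 polytopes: the constraints of `KZ.IsGeodesicPolytope 2 P`
are `0 < L₀ i • Ql p` for finitely many rows `L₀ i ∈ ℚ̄⁴`. [cite: Goncharov1999, §1.1] -/
theorem nf_rows_of_isGeodesicPolytope {Ql : (Fin 3 → ℝ) → Fin 4 → ℝ}
    (hQl : ∀ p, Ql p = ![p 0 ^ 2 + p 1 ^ 2 + p 2 ^ 2, p 0, p 1, 1])
    {P : Set (Fin 3 → ℝ)} (hP : KZ.IsGeodesicPolytope 2 P) :
    ∃ (k : ℕ) (L₀ : Fin k → Fin 4 → ℝ), (∀ i c, IsAlgebraic ℚ (L₀ i c)) ∧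
      P = {p | 0 < p 2 ∧ ∀ i, 0 < ∑ c, L₀ i c * Ql p c} := by
  obtain ⟨k, flat, a, d, ε, ha, hd, hε, hlast, hPeq, -⟩ := hP
  obtain ⟨L₀, halg, hset⟩ := nf_rows_of_data hQl flat a d ε ha hd hε hlast
  exact ⟨k, L₀, halg, hPeq.trans hset⟩

/-- The normal form of a NONEMPTY lifted constraint family: keep a minimal sub-family of rows cutting
out the same set and re-index it by `Fin`; then every kept row is negative somewhere in the upper
half-space (ND1), the kept rows are pairwise non-proportional (ND2), and every kept row has a
non-zero trace part. [folklore] -/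
theorem nf_normalForm {Ql : (Fin 3 → ℝ) → Fin 4 → ℝ}
    (hQl : ∀ p, Ql p = ![p 0 ^ 2 + p 1 ^ 2 + p 2 ^ 2, p 0, p 1, 1])
    {k : ℕ} (L₀ : Fin k → Fin 4 → ℝ) (halg : ∀ i c, IsAlgebraic ℚ (L₀ i c))
    {P : Set (Fin 3 → ℝ)} (hP : P = {p | 0 < p 2 ∧ ∀ i, 0 < ∑ c, L₀ i c * Ql p c})
    (hne : P.Nonempty) :
    ∃ (k : ℕ) (L : Fin k → Fin 4 → ℝ),
      (∀ i c, IsAlgebraic ℚ (L i c)) ∧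
      P = {p | 0 < p 2 ∧ ∀ i, 0 < ∑ c, L i c * Ql p c} ∧
      P.Nonempty ∧
      (∀ i, ∃ p : Fin 3 → ℝ, 0 < p 2 ∧ ∑ c, L i c * Ql p c < 0) ∧
      (∀ i j, i ≠ j → ∀ μ : ℝ, L i ≠ μ • L j) ∧
      (∀ i, L i 0 ≠ 0 ∨ L i 1 ≠ 0 ∨ L i 2 ≠ 0) := by
  obtain ⟨S, hS, hmin⟩ :=
    nf_exists_minimal {p : Fin 3 → ℝ | 0 < p 2} (fun i p => ∑ c, L₀ i c * Ql p c)
  have hS' : ∀ p : Fin 3 → ℝ, (0 < p 2 ∧ ∀ i ∈ S, 0 < ∑ c, L₀ i c * Ql p c) ↔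
      (0 < p 2 ∧ ∀ i, 0 < ∑ c, L₀ i c * Ql p c) := fun p => Set.ext_iff.1 hS p
  have hmin' : ∀ i ∈ S, ∃ p : Fin 3 → ℝ, 0 < p 2 ∧ ∑ c, L₀ i c * Ql p c ≤ 0 ∧
      ∀ j ∈ S, j ≠ i → 0 < ∑ c, L₀ j c * Ql p c := hmin
  obtain ⟨p₀, hp₀⟩ := hne
  have hp₀' : 0 < p₀ 2 ∧ ∀ i, 0 < ∑ c, L₀ i c * Ql p₀ c := by
    have h := hp₀
    rw [hP] at h
    exact h
  obtain ⟨n, e, he_inj, he_mem, he_surj⟩ : ∃ (n : ℕ) (e : Fin n → Fin k), Function.Injective e ∧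
      (∀ m, e m ∈ S) ∧ ∀ i ∈ S, ∃ m, e m = i :=
    ⟨S.card, S.orderEmbOfFin rfl, (S.orderEmbOfFin rfl).injective,
      fun m => Finset.orderEmbOfFin_mem S rfl m, fun i hi => by
        have h : i ∈ Set.range (S.orderEmbOfFin rfl) := by
          rw [Finset.range_orderEmbOfFin]
          exact hi
        exact h⟩
  refine ⟨n, fun m => L₀ (e m), fun m c => halg _ _, ?_, ⟨p₀, hp₀⟩, ?_, ?_, ?_⟩
  · show P = {p | 0 < p 2 ∧ ∀ m, 0 < ∑ c, L₀ (e m) c * Ql p c}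
    rw [hP]
    ext p
    exact (hS' p).symm.trans (and_congr_right fun _ =>
      ⟨fun h m => h (e m) (he_mem m), fun h i hi => by
        obtain ⟨m, rfl⟩ := he_surj i hi
        exact h m⟩)
  · intro m
    show ∃ p : Fin 3 → ℝ, 0 < p 2 ∧ ∑ c, L₀ (e m) c * Ql p c < 0
    obtain ⟨p, hp, hle, -⟩ := hmin' (e m) (he_mem m)
    obtain ⟨r, hr, hneg⟩ := nf_exists_neg (L₀ (e m)) p p₀ hp
      (by rw [← nf_eval hQl (L₀ (e m)) p]; exact hle)
      (by rw [← nf_eval hQl (L₀ (e m)) p₀]; exact hp₀'.2 (e m))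
    exact ⟨r, hr, by rw [nf_eval hQl (L₀ (e m)) r]; exact hneg⟩
  · intro m m' hmm' μ hμ
    have hμ' : L₀ (e m) = μ • L₀ (e m') := hμ
    obtain ⟨p, -, hle, hothers⟩ := hmin' (e m) (he_mem m)
    have hj : 0 < ∑ c, L₀ (e m') c * Ql p c :=
      hothers (e m') (he_mem m') (fun h => hmm' (he_inj h).symm)
    have hprop : ∀ q : Fin 3 → ℝ,
        ∑ c, L₀ (e m) c * Ql q c = μ * ∑ c, L₀ (e m') c * Ql q c := by
      intro q
      rw [hμ', Finset.mul_sum]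
      refine Finset.sum_congr rfl fun c _ => ?_
      rw [Pi.smul_apply, smul_eq_mul, mul_assoc]
    have h1 : 0 < μ * ∑ c, L₀ (e m') c * Ql p₀ c := by
      rw [← hprop]
      exact hp₀'.2 (e m)
    have hμpos : 0 < μ := pos_of_mul_pos_left h1 (hp₀'.2 (e m')).le
    have hle' : μ * ∑ c, L₀ (e m') c * Ql p c ≤ 0 := by
      rw [← hprop]
      exact hle
    exact absurd (mul_pos hμpos hj) (not_lt.2 hle')
  · intro m
    show L₀ (e m) 0 ≠ 0 ∨ L₀ (e m) 1 ≠ 0 ∨ L₀ (e m) 2 ≠ 0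
    by_contra h0
    push Not at h0
    obtain ⟨h00, h01, h02⟩ := h0
    obtain ⟨p, -, hle, -⟩ := hmin' (e m) (he_mem m)
    have h1 : 0 < ∑ c, L₀ (e m) c * Ql p₀ c := hp₀'.2 (e m)
    rw [nf_eval hQl, h00, h01, h02] at h1 hle
    linarith

/-- STUB `stub_rungTwoNormalForm` (v5): every rung-2 polytope is empty or has a NORMAL FORM in the
paraboloid lift — finitely many linear constraints `0 < L i • Ql p` with algebraic coefficients,
nonempty, every constraint negative somewhere in `ℍ³` (vacuous / radius-zero / constant constraints
dropped: they do not change `P`), pairwise non-proportional rows (a duplicated half-space is dropped;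
an opposite pair would make `P` empty), every row with a non-zero trace part.
[cite: Goncharov1999, §1.1] -/
theorem stub_rungTwoNormalForm :
    ∀ (Ql : (Fin 3 → ℝ) → Fin 4 → ℝ), (∀ p, Ql p = ![p 0 ^ 2 + p 1 ^ 2 + p 2 ^ 2, p 0, p 1, 1]) →
    ∀ (P : Set (Fin 3 → ℝ)), KZ.IsGeodesicPolytope 2 P →
      P = ∅ ∨ ∃ (k : ℕ) (L : Fin k → Fin 4 → ℝ),
        (∀ i c, IsAlgebraic ℚ (L i c)) ∧
        P = {p | 0 < p 2 ∧ ∀ i, 0 < ∑ c, L i c * Ql p c} ∧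
        P.Nonempty ∧
        (∀ i, ∃ p : Fin 3 → ℝ, 0 < p 2 ∧ ∑ c, L i c * Ql p c < 0) ∧
        (∀ i j, i ≠ j → ∀ μ : ℝ, L i ≠ μ • L j) ∧
        (∀ i, L i 0 ≠ 0 ∨ L i 1 ≠ 0 ∨ L i 2 ≠ 0) := by
  intro Ql hQl P hP
  rcases P.eq_empty_or_nonempty with h | hne
  · exact Or.inl h
  · obtain ⟨k, L₀, halg, hPeq⟩ := nf_rows_of_isGeodesicPolytope hQl hP
    exact Or.inr (nf_normalForm hQl L₀ halg hPeq hne)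

end Summit.KontsevichZagierPeriods.HyperbolicBloch.OffTetraSectorKernel
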